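import Mathlib.Analysis.Asymptotics.Defs
import Mathlib.Data.Fin.Tuple.NatAntidiagonal
import Literature.NumberTheory.LFunctions.KeiperLiZeroSum
import Literature.NumberTheory.LFunctions.BombieriLagariasEtaIdentification
import Literature.NumberTheory.LFunctions.LiCoefficientArithmeticFormulaProofs
import Literature.NumberTheory.LFunctions.Xiao2020.KeiperLiTaylor
import Literature.NumberTheory.LFunctions.ZetaZeroReciprocalSum
import Literature.NumberTheory.LFunctions.LagariasXiShiftHermiteBiehlerProofs
import HarnessLib

/-!
# RH-FREE corpus typing (cell `rh-crit/dbl`, seat t13): asymptotic criteria and exact forms for the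
# Keiper–Li coefficients — Voros 2006, Coffey 2008, Voros 2018

LINE 1 — LABEL: RH-FREE corpus typing.  The asymptotic criterion of Voros (2006) is typed as TWO
declarations, `Voros2006_thm_onlyif` (RH-CONSEQUENCE: `RH → λ_n ∼ ½ n log n + C₁ n (mod o(n))`) and
`Voros2006_thm_if` (the converse, an RH-FREE implication whose HYPOTHESIS is of RH strength); their
conjunction `Voros2006_thm_iff` is RH-EQUIVALENT (l.1).  Every other declaration is an RH-FREE identity,
bound or definition.  bears_on: LADDER-RH L-C/L-P (COLUMN 4 LI).  WHAT THIS IS NOT: not a route, not a proof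
plan for RH; typing a criterion fixes WHICH asymptotic statement would prove RH, it does not move RH;
nothing here bears on the truth of RH.

Topic `Literature/NumberTheory/LFunctions`; siblings and CITED tree vocabulary (never restated):
`RiemannXi.lean` (`keiperLiCoeff n` = Li's `λ_n`, `riemannXi` = Riemann's `ξ`, so Voros's `Ξ = 2ξ` and
Voros's/Coffey's `2ξ(1) = 1`), `LiCoefficientArithmeticFormula.lean` (`liArchSum` = Coffey's `S₁`,
`liTrend` = Maślanka's/Voros's trend `S̄_n`, `liOscPart` = Coffey's `S₂` = Voros's `S_n`, `liEta` = the
Bombieri–Lagarias/Coffey `η_k`, `liC1 = ½(γ − 1 − log 2π)`; facts `Coffey2005_thm1/2`, `Lagarias2007_thm51_zeta`,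
all `_holds`), `KeiperLiTrend.lean` (`abs_keiperLiCoeff_sub_osc_sub_trend_le`, `keiperLiTrend_log_bounds`,
`tendsto_keiperLiCoeff_sub_osc_sub_trend` — Voros 2006 §4 up to `O(1)`/`O(1/n)`), `KeiperLiZeroSum.lean`
(`keiperLiCoeff_eq_tsum_zeros`, `riemannHypothesis_iff_forall_tsum_nonneg`),
`BombieriLagariasZeroLocation.lean` (`bombieriLagarias1999_theorem1(_pos)(_of_bddBelow)`),
`Xiao2020/KeiperLiTaylor.lean` (`logXiTaylorCoeff k = (log ξ)^{(k)}(1)/k!`, `zetaOneTaylorCoeff`,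
`zetaOneLogDerivCoeff`, `keiperLiCoeff_eq_sum_logXiTaylorCoeff`, `logXiTaylorCoeff_succ`),
`BombieriLagariasEtaIdentification.lean` (`liEta_eq_neg_re_zetaOneLogDerivCoeff`, `Coffey2005_thm1_holds`),
`BombieriLagariasEtaLimit.lean` (`tendsto_sum_log_pow_div_sub_exists` — the Stieltjes-type limits exist),
`ZetaZeroReciprocalSum.lean` (`tsum_zeroOrder_div_mul_one_sub_eq_nicolasBeta`:
`Σ_ρ m(ρ)/(ρ(1−ρ)) = β = 2 + γ − log π − 2 log 2`), `ZetaZeros.riemannZetaNontrivialZeros` with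
multiplicities `riemannZetaZeroOrder`.

## Sources and what is typed (STEP-0 reads of the held texts; locators = arXiv page of the held text)

* **[Voros2006]** A. Voros, *Sharpenings of Li's criterion for the Riemann Hypothesis*, Math. Phys. Anal.
  Geom. 9 (2006) 53–63 = arXiv:math/0506326v2 (held `paper:arxiv-math_0506326`; displayed equations are cited
  by their TeX labels and arXiv page).  §1: Li's `λ_n` «are `n` times Keiper's» (`keiperLambdaK`); the
  secondary zeta function `Z(σ) = Σ_k x_k^{−σ}`, `x_k = ρ(1−ρ) = ¼ + τ_k²` over zero PAIRS, eq. (ZDef) p.2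
  (`vorosZ`, at positive integers only).  §2: the exact finite form `λ_n = −n Σ_{j=1}^n ((−1)^j/j)
  C(n+j−1, 2j−1) Z(j)`, eq. (LZS) p.3 (`Voros2006_eqLZS`, fact) and its inverse `Z(j) = Σ_{n=1}^j (−1)^{n+1}
  C(2j, j−n) λ_n` p.3 (`Voros2006_eqZinv`, fact); Keiper's `λ_n = Σ_j (−1)^{j+1} C(n,j) 𝒵_j` and
  `𝒵_j = 1 − (1−2^{−j})ζ(j) + (−1)^j η_{j−1}` are the tree's `keiperLiCoeff_eq_sum_logXiTaylorCoeff` /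
  `logXiTaylorCoeff_succ` read through `Coffey2008_eq34` below.  §3: the single unnumbered **Theorem
  (asymptotic criterion for the Riemann Hypothesis)**, p.6, eqs. (RER)/(RS): `Voros2006_thm_onlyif`,
  `Voros2006_thm_if`, `Voros2006_thm_iff`; the general engine «(NT) ⟹ (REs) if all the zeros have Re ρ = ½»
  (Oesterlé's argument, printed in full p.5–6) as the RH-FREE real-analysis statement `Voros2006_NT_REs`;
  Darboux's asymptotic (DA) p.4 = (RS) p.6 for the RH-false side, typed SIGN-CORRECTED and in the
  finite-radius form the author himself gives in [Voros2018] §1.2 footnote 1 / eq. (ASF) («in [V] [VB] we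
  missed the overall (−) sign … rectified in [VK]»; «λ_n^L ∼ −Σ_{Re ρ' > ½} z_{ρ'}^{−n} (mod o(r^{−n}) ∀ r < 1)»):
  `Voros2006_eqDA`.  §4: `S_n = liOscPart n`, `S̄_n = liTrend n` (eqs. (SN), (TN) p.7); the unconditional
  full asymptotic expansion of the trend, eq. (TS) p.7, in the form (4.4)+(TN) `S̄_n = (n/2)(H_n − 1 − log 2π)
  + ½ + o(n^{−N}) ∀ N` (`Voros2006_eqTS`, fact; the tree has `O(1)` with constant `2/π` and `O(1/n)`);
  `RH ⇒ S_n = o(n)`, eq. (SLN) p.7 (`isLittleO_liOscPart_of_onlyif`, PROVED from `Voros2006_thm_onlyif`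
  and the tree's trend law).  §3/§5 saddle-point discussion, the «sensitivity» estimates `n ≳ 10¹⁸`, and
  `δλ_n = 2Z(0) = 7/4`: HEURISTICS — docstring remarks only, never facts.
* **[Coffey2008]** M. W. Coffey, *New results concerning power series expansions of the Riemann xi function
  and the Li/Keiper constants*, Proc. R. Soc. A 464 (2008) 711–731 (held `paper:doi-10-1098-rspa-2007-0212`;
  PDF page `k` = printed page `710 + k`).  §2–§3: the Stieltjes constants `γ_k` by the limit (3.2) p.714
  (`stieltjesGammaSeq`, `stieltjesGamma`; existence of the limit PROVED from the tree; `γ₀ = γ`), their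
  Laurent rôle (3.1) (`Coffey2008_eq31`, fact), the zero power sums `σ_k = Σ_ρ ρ^{−k}` (3.3) p.714
  (`zetaZeroPowerSum`, symmetric summation), `log ξ(s) = −log 2 − Σ_k (−1)^k (σ_k/k)(s−1)^k` (3.4)
  (`Coffey2008_eq34`, fact — the Hadamard-product input), (3.5) `λ_n = −Σ_j (−1)^j C(n,j) σ_j` and (3.6)
  `σ_k = (−1)^k η_{k−1} − (1−2^{−k})ζ(k) + 1` PROVED from (3.4) and the tree, (3.7) `σ₁ = λ₁ = 1 + γ/2 −
  ½ log π − log 2` PROVED; **Prop. 3.2** (3.12) p.715 (Matsuoka's formula for `η_{k−1}` in the `γ_j`) and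
  **Prop. 3.1** (3.10) p.715 (`λ_n` in the `γ_j`) as facts, with `Prop. 3.1 ⇐ Prop. 3.2` PROVED; §4: (4.10)
  p.718 (`Coffey2008_eq410`), **Prop. 4.1** (4.12) p.718 (typed in the form the printed proof yields — see
  its docstring for an OCR/misprint discrepancy in the held text), **Prop. 4.2** p.719 (strict sign
  alternation of `η_j`), and (4.17)/(4.18) `(1−2^{−k})ζ(k) − 1 = Σ_{j≥1}(2j+1)^{−k} > 3^{−k}` PROVED.
  Deliberately NOT here (second wave, OCR of the multi-line displays is not reliable enough to type
  from / needs the Glaisher–Kinkelin constant): **Props. 5.1, 5.2** (series for `γ_k`, `η_{p−1}` in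
  Bernoulli numbers, p.720), **App. A** Props. A.1, A.2, Cor. A.3, Prop. A.4 (Lehmer sums, `ζ'(2)`,
  `Σ η_j = −1 − log 2π + 12 log A`, p.726–729); §6–§7 («a conjecture implying the RH is stronger than it»,
  Brownian-motion heuristics): remarks only.
* **[Voros2018]** A. Voros, *Discretized Keiper/Li approach to the Riemann Hypothesis*, Exp. Math. 29
  (2020) = arXiv:1703.02844v3 (held `paper:arxiv-1703.02844`; README S20 misattributes it to Sekatskii).
  §2.1: the explicit sequence `Λ_n = (−1)^n Σ_{m=1}^n (−1)^m A_{nm} log 2ξ(2m)`, eqs. (Anm), (EKL) p.5–6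
  (`vorosA`, `vorosLambda`, value `Λ₁ = (3/2) log(π/3)` PROVED), the partial-fraction identities (AID) p.5
  (`Voros2018_eqAID`, fact), and §2.3 `Λ_n = Σ*_ρ F_n(ρ)`, eq. (LIR) p.6 («Proof (outlined)»;
  `Voros2018_eqLIR`, fact).  §3 «Resulting new sequential criterion» (LNRH)/(LRH): the derivation is
  steepest-descent «with caveats» (§3.2) and step 1 of §3.3 is conditional on «a nonstationary-phase
  principle» — NOT typed as facts (docstring remark on `vorosLambda`); §3.4 «we conjecture that Li's
  criterion fully holds for {Λ_n}» — a CONJECTURE, never a Literature fact (planner.md 4b).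
* NOT typed, by ruling of `LIT-LOCATORS-dbl.md` §3/§6 (E1, E2, E8, E10): Connon arXiv:0902.1691 /
  arXiv:1002.3484 (unrefereed manuscripts), McPhedran arXiv:2407.00060 «Sandwiching the RH» (unrefereed),
  Arias de Reyna 2011 (Funct. Approx. 45; NOT HELD, acq-10925), Keiper 1992 (formulas OCR-garbled; only the
  `λ^K/λ^L` dictionary is used, through Voros's printed statement).

## Status of the named facts (2026-08-26; docstring-only update, statements unchanged)

ALL 16 named facts of this module are DISCHARGED in the kernel (`…_holds`, axioms
`propext`/`Classical.choice`/`Quot.sound` only); users should cite the theorems rather than take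
`(h : …)` hypotheses:

* `KeiperLiAsymptoticCriteriaProofs.lean` (rh-crit-dbl-t13): `Voros2006_eqLZS_holds`, `Voros2006_eqZinv_holds`,
  `Voros2006_thm_if_holds`, `Voros2006_eqDA_holds`, `Coffey2008_eq31_holds`, `Coffey2008_eq34_holds`,
  `Coffey2008_prop32_holds`, `Coffey2008_prop31_holds`, `Coffey2008_eq410_holds`, `Coffey2008_prop41_holds`,
  `Coffey2008_prop42_holds` (strict sign alternation of `η_j` for every `j`, RH-FREE), `Voros2018_eqAID_holds`.
* `KeiperLiTrendAsymptoticProofs.lean` (rh-crit-dbl-t13): `Voros2006_eqTS_holds`.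
* `Voros2006OesterleProofs.lean` (rh-crit-gm-t14): `Voros2006_NT_REs_holds`, `Voros2006_thm_onlyif_holds`
  (RH-CONSEQUENCE with its explicit `RiemannHypothesis →` binder), and the assembled iff
  `Voros2006_thm_iff_holds` (RH-EQUIVALENT on its line 1: `RH ↔ λ_n − ½n(log n − 1 + γ − log 2π) = o(n)`).
* `VorosLiIntegralRepresentationProofs.lean` (rh-crit-dbl-t12): `Voros2018_eqLIR_holds`.

Nothing of this module remains a hypothesis.  LABEL unchanged: RH-FREE corpus literature with the
RH-CONSEQUENCE / RH-EQUIVALENT items labelled at their decls; a discharged criterion fixes WHICH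
asymptotic statement is equivalent to RH, it does not move RH; nothing here bears on the truth of RH.

## References

* [Voros2006] A. Voros, Math. Phys. Anal. Geom. 9 (2006) 53–63, doi:10.1007/s11040-005-9002-8.
* [Coffey2008] M. W. Coffey, Proc. R. Soc. A 464 (2008) 711–731, doi:10.1098/rspa.2007.0212.
* [Voros2018] A. Voros, arXiv:1703.02844v3, doi:10.1080/10586458.2018.1482480.
* [Keiper1992] J. B. Keiper, Math. Comp. 58 (1992) 765–773 (secondary, via [Voros2006] §1, [Voros2018] §1.1).
* [BombieriLagarias1999] E. Bombieri, J. C. Lagarias, J. Number Theory 77 (1999) 274–287.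
* [Coffey2005LiCriterion] M. W. Coffey, Math. Phys. Anal. Geom. 8 (2005) 211–255.
-/

noncomputable section

open Filter Topology Asymptotics Finset
open scoped ComplexConjugate

namespace Literature.NumberTheory.LFunctions

/-- Reindexing `Icc 1 n` by `range n`. [folklore] -/
private theorem sum_Icc_eq_sum_range_succ {M : Type*} [AddCommMonoid M] (g : ℕ → M) (n : ℕ) :
    ∑ m ∈ Finset.Icc 1 n, g m = ∑ i ∈ Finset.range n, g (i + 1) := by
  rw [← Finset.Ico_add_one_right_eq_Icc, Finset.sum_Ico_eq_sum_range]
  simp only [Nat.add_sub_cancel, add_comm 1]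

/-! ## §1. Dictionary: Keiper's and Li's normalisations ([Voros2006] §1, [Voros2018] §1.1) -/

/-- RH-FREE (definition). **Keiper's coefficients** `λ^K_n := λ^L_n / n`, where `λ^L_n = keiperLiCoeff n`
is Li's coefficient: «in the notations of Li, whose `λ_n` are `n` times Keiper's» ([Voros2006] §1, eq.
(LDef), p.2); «`λ^L_n ≡ n λ^K_n`, `n = 1, 2, …`» ([Voros2018] §1.1, p.3, after (LIp)); Keiper's own
generating function is `log 2ξ(1/(1−z)) = Σ_{n≥1} λ^K_n zⁿ` ([Voros2018] (KEd); [Keiper1992] (28)–(33),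
secondary).  Junk value `λ^K_0 = keiperLiCoeff 0 / 0 = 0`. [cite: Voros2006, §1 eq. (LDef) p.2; Voros2018, §1.1 p.3] -/
def keiperLambdaK (n : ℕ) : ℝ :=
  keiperLiCoeff n / n

/-- RH-FREE. `λ^L_n = n · λ^K_n` for `n ≥ 1`. [cite: Voros2018, §1.1 p.3 («λ^L_n ≡ n λ^K_n»)] -/
theorem keiperLiCoeff_eq_mul_keiperLambdaK {n : ℕ} (hn : 1 ≤ n) :
    keiperLiCoeff n = n * keiperLambdaK n := by
  have h : (n : ℝ) ≠ 0 := by exact_mod_cast (show n ≠ 0 by omega)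
  unfold keiperLambdaK
  field_simp

/-- RH-FREE. The printed main term of [Voros2006] (RER), `½ n (log n − 1 + γ − log 2π)`, is the tree's
`(n/2) log n + C₁ n` with `C₁ = liC1 = ½(γ − 1 − log 2π)` (Lagarias's constant; the rh-li cell's
`liMainTerm`). [cite: Voros2006, §3 Theorem, eq. (RER) p.6] -/
theorem voros_mainTerm_eq (n : ℕ) :
    (n : ℝ) / 2 * (Real.log n - 1 + Real.eulerMascheroniConstant - Real.log (2 * Real.pi)) =
      (n : ℝ) / 2 * Real.log n + liC1 * n := by
  rw [liC1]; ring

/-! ## §2. Voros's secondary zeta function over the zeros and the exact forms ([Voros2006] §1–§2) -/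

/-- RH-FREE (definition). **Voros's secondary zeta function at a positive integer**,
`Z(j) = Σ_k x_k^{−j}`, the sum over the PAIRS `{ρ, 1−ρ} = {½ ± iτ_k}` of non-trivial zeros (with
multiplicity), `x_k = ρ(1−ρ) = ¼ + τ_k²` ([Voros2006] eqs. (Pairs), (ZDef), p.2: «`Z(σ) = Σ_{k≥1} x_k^{−σ}`,
`Re σ > ½`»).  Written over the tree's zero set with multiplicities `m(ρ) = riemannZetaZeroOrder ρ`: every
pair is met twice when summing over all `ρ`, whence the factor `½`.  Absolutely convergent for `j ≥ 1`
(`|ρ(1−ρ)| ≥ |Im ρ|² > 196`); junk value `0·∞`-free but meaningless at `j = 0` (Voros's `Z(0) = 7/4` is the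
value of the meromorphic continuation, [Voros2006] (4.?) «`δλ_n = 2Z(0) = +7/4`» p.6 — a remark, not used).
-- TODO(general form): `Z(σ)` for complex `σ`, `Re σ > ½`, its meromorphic continuation and polar part
-- `Z(½+ε) = (8π)^{−1} ε^{−2} − (4π)^{−1} log(2π) ε^{−1} + O(1)` ([Voros2006] (DPol), (EX) p.2; [Voros 2003]).
[cite: Voros2006, §1 eq. (ZDef) p.2] -/
def vorosZ (j : ℕ) : ℂ :=
  1 / 2 * ∑' ρ : ZetaZeros.riemannZetaNontrivialZeros,
    (riemannZetaZeroOrder (ρ : ℂ) : ℂ) * (((ρ : ℂ) * (1 - ρ))⁻¹) ^ j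

/-- RH-FREE. `Z(1) = ½ Σ_ρ m(ρ)/(ρ(1−ρ)) = β/2` with Nicolas's `β = 2 + γ − log π − 2 log 2 = 0.04619…`
(tree: `tsum_zeroOrder_div_mul_one_sub_eq_nicolasBeta`); so `Z(1) = λ₁ = 0.0230957…`
([Coffey2008] (3.7), (4.8)). [cite: Voros2006, §1 eq. (ZDef) p.2; Coffey2008, eq. (3.7) p.714] -/
theorem vorosZ_one : vorosZ 1 = (nicolasBeta : ℂ) / 2 := by
  have h := tsum_zeroOrder_div_mul_one_sub_eq_nicolasBeta
  unfold vorosZ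
  simp only [pow_one]
  have e : (fun ρ : ZetaZeros.riemannZetaNontrivialZeros ↦
      (riemannZetaZeroOrder (ρ : ℂ) : ℂ) * ((ρ : ℂ) * (1 - ρ))⁻¹) =
      fun ρ : ZetaZeros.riemannZetaNontrivialZeros ↦
        (riemannZetaZeroOrder (ρ : ℂ) : ℂ) / ((ρ : ℂ) * (1 - ρ)) := by
    funext ρ; rw [div_eq_mul_inv]
  rw [e]
  exact (congrArg (fun z : ℂ ↦ 1 / 2 * z) h).trans (by ring)

/-- RH-FREE NAMED FACT ([Voros2006] §2, eq. (LZS), p.3): **the exact finite oscillatory form**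

  `λ_n = −n Σ_{j=1}^n ((−1)^j / j) C(n+j−1, 2j−1) Z(j)`  (`n ≥ 1`),

obtained from `log Ξ(1/(1−z)) = Σ_k log[1 + z/((1−z)² x_k)]` and the generalized binomial formula (per pair
this is `2 − 2T_n(1 − 1/(2x_k))`, `T_n` the Chebyshev polynomial).  PROVED: `Voros2006_eqLZS_holds`
(`KeiperLiAsymptoticCriteriaProofs.lean`). [cite: Voros2006, §2 eq. (LZS) p.3] -/
def Voros2006_eqLZS : Prop :=
  ∀ n : ℕ, 1 ≤ n → (keiperLiCoeff n : ℂ) =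
    -(n : ℂ) * ∑ j ∈ Finset.Icc 1 n,
      (-1 : ℂ) ^ j / (j : ℂ) * (((n + j - 1).choose (2 * j - 1) : ℕ) : ℂ) * vorosZ j

/-- RH-FREE NAMED FACT ([Voros2006] §2, third remark, p.3): **the inverse relation**
`Z(j) = Σ_{n=1}^j (−1)^{n+1} C(2j, j−n) λ_n` (`j ≥ 1`), «by the same technique as for [Vz]».
PROVED: `Voros2006_eqZinv_holds` (`KeiperLiAsymptoticCriteriaProofs.lean`). [cite: Voros2006, §2 p.3 (displayed inverse of (LZS))] -/
def Voros2006_eqZinv : Prop :=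
  ∀ j : ℕ, 1 ≤ j → vorosZ j =
    ∑ n ∈ Finset.Icc 1 j, (-1 : ℂ) ^ (n + 1) * (((2 * j).choose (j - n) : ℕ) : ℂ) * (keiperLiCoeff n : ℂ)

/-! ## §3. The asymptotic criterion ([Voros2006] §3, Theorem p.6) -/

/-- RH-FREE NAMED FACT — **Oesterlé's argument in Voros's general setting** ([Voros2006] §3, p.5–6:
«we ask that for some constants `R₋₂`, `R₋₁` and some `α < 1` … `N(T) = 2T[2R₋₂(log T − 1) + R₋₁] + δN(T)`,
`δN(T) = O(T^α)` (NT) … either (NT) ⟹ (REs) if all the zeros have `Re ρ = ½`»; proof printed p.5–6: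
Stieltjes integral `λ_n = 2∫(1 − cos nθ(T)) dN(T)`, `θ(T) = 2 arctan(1/2T)`, integration by parts,
Riemann–Lebesgue, `∫₀^∞ (sin t/t)[8R₋₂(log(n/t) − 1) + 4R₋₁] dt` in closed form).  A statement of REAL
ANALYSIS about point configurations on the critical line, no zeta function involved: for ordinates
`0 < τ₀ ≤ τ₁ ≤ …  → ∞` (listed with multiplicity) whose counting function `N(T) = #{k : τ_k ≤ T}` obeys (NT)
with `α < 1`, the Li-type sums over the pairs `ρ_k = ½ ± iτ_k`,
`λ_n := Σ_k [1 − (1 − 1/ρ_k)ⁿ] + c.c. = Σ_k 2(1 − Re(1 − 1/ρ_k)ⁿ)`, satisfy (REs):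
`λ_n = 2πn[2R₋₂(log n − 1 + γ) + R₋₁] + o(n)`.  For `ζ` under RH, `R₋₂ = 1/(8π)`, `R₋₁ = −log(2π)/(4π)`
(eq. (EX)) and (REs) is (RER).  PROVED: `Voros2006_NT_REs_holds` (`Voros2006OesterleProofs.lean`,
rh-crit-gm-t14: Oesterlé's argument + the log-sine integral `∫₀^∞ log s · sin s/s ds = −πγ/2`).
[cite: Voros2006, §3 eqs. (NT), (REs) p.5 and the proof p.5–6] -/
def Voros2006_NT_REs : Prop :=
  ∀ (τ : ℕ → ℝ), (∀ k, 0 < τ k) → Monotone τ → Tendsto τ atTop atTop →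
    ∀ (R₂ R₁ α : ℝ), α < 1 →
      (fun T : ℝ ↦ (Nat.card {k : ℕ | τ k ≤ T} : ℝ) - 2 * T * (2 * R₂ * (Real.log T - 1) + R₁))
          =O[atTop] (fun T : ℝ ↦ T ^ α) →
        (fun n : ℕ ↦ (∑' k : ℕ, 2 * (1 - ((1 - 1 / ((1 / 2 : ℂ) + τ k * Complex.I)) ^ n).re)) -
            2 * Real.pi * n * (2 * R₂ * (Real.log n - 1 + Real.eulerMascheroniConstant) + R₁))
          =o[atTop] (fun n : ℕ ↦ (n : ℝ))

/-- RH-CONSEQUENCE NAMED FACT ([Voros2006] §3 **Theorem (asymptotic criterion for the Riemann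
Hypothesis)**, p.6, the `[RH true] ⇒` half of eq. (RER)): «`[RH true] ⇔` tempered growth to `+∞`, as
`λ_n ∼ ½ n (log n − 1 + γ − log 2π) (mod o(n))`».  This direction is Oesterlé's theorem (unpublished 2000;
proof printed by Voros p.5–6 = `Voros2006_NT_REs` at `R₋₂ = 1/(8π)`, `R₋₁ = −log(2π)/(4π)` plus the
Riemann–von Mangoldt formula); [Voros2018] eq. (OE)/(ASC).  Later sharpenings NOT typed here: `O(√n log n)`
(Lagarias 2007, Thm. 1.1/6.1), `n·y_n` with `{y_n} ∈ ℓ²` (Arias de Reyna 2011, not held).  The explicit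
binder `RiemannHypothesis →` is the printed «if RH is true». PROVED: `Voros2006_thm_onlyif_holds`
(`Voros2006OesterleProofs.lean`; and `Voros2006_thm_iff_holds` there assembles the iff). [cite: Voros2006, §3 Theorem, eq. (RER) p.6] -/
def Voros2006_thm_onlyif : Prop :=
  RiemannHypothesis →
    (fun n : ℕ ↦ keiperLiCoeff n -
        (n : ℝ) / 2 * (Real.log n - 1 + Real.eulerMascheroniConstant - Real.log (2 * Real.pi)))
      =o[atTop] (fun n : ℕ ↦ (n : ℝ))

/-- RH-FREE NAMED FACT (an implication whose hypothesis is of RH strength) ([Voros2006] §3 Theorem p.6,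
the `⇐` half of the `[RH true]` line): if `λ_n = ½ n (log n − 1 + γ − log 2π) + o(n)` then RH.  Printed
justification p.6: «In [BL], rather weak exponential lower bounds `λ_n ≥ −c e^{εn}` were shown to imply RH;
the backward assertion [RH true] ⇐ (RER) is thus also implied by [BL]» (equivalently: by the mutual
exclusivity of (RER) with Darboux's form (RS) = `Voros2006_eqDA`).  Dischargeable from the tree
(`bombieriLagarias1999_theorem1_pos_of_bddBelow`, `keiperLiCoeff_eq_tsum_zeros`).  PROVED:
`Voros2006_thm_if_holds` (`KeiperLiAsymptoticCriteriaProofs.lean`). [cite: Voros2006, §3 Theorem p.6 and the [BL] remark p.6] -/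
def Voros2006_thm_if : Prop :=
  (fun n : ℕ ↦ keiperLiCoeff n -
        (n : ℝ) / 2 * (Real.log n - 1 + Real.eulerMascheroniConstant - Real.log (2 * Real.pi)))
      =o[atTop] (fun n : ℕ ↦ (n : ℝ)) →
    RiemannHypothesis

/-- RH-EQUIVALENT (l.1): `⇒` = `Voros2006_thm_onlyif` (RH-CONSEQUENCE, Oesterlé/Voros, proved in print),
`⇐` = `Voros2006_thm_if` (via Bombieri–Lagarias).  **[Voros2006] Theorem (asymptotic criterion), first
line**: `RH ⇔ λ_n ∼ ½ n (log n − 1 + γ − log 2π) (mod o(n))`.  Glue, PROVED from the two named halves.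
[cite: Voros2006, §3 Theorem, eq. (RER) p.6] -/
theorem Voros2006_thm_iff (h₁ : Voros2006_thm_onlyif) (h₂ : Voros2006_thm_if) :
    RiemannHypothesis ↔
      (fun n : ℕ ↦ keiperLiCoeff n -
          (n : ℝ) / 2 * (Real.log n - 1 + Real.eulerMascheroniConstant - Real.log (2 * Real.pi)))
        =o[atTop] (fun n : ℕ ↦ (n : ℝ)) :=
  ⟨h₁, h₂⟩

/-- RH-FREE NAMED FACT, unconditional — **Darboux's asymptotic for the `λ_n`** ([Voros2006] §3, eq. (DA)
p.4, «which now holds for multiple zeros as well, counted with their multiplicities», restated as (RS) in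
the Theorem p.6), with the overall SIGN CORRECTED as by the author in [Voros2018] §1.2, footnote 1 and
eq. (ASF): «`λ^L_n ∼ −Σ_{Re ρ' > ½} z_{ρ'}^{−n} (mod o(r^{−n}) ∀ r < 1)`», `z_ρ = 1 − 1/ρ`
(`|z_ρ| < 1 ⇔ Re ρ > ½`, tree `BombieriLagarias.norm_inv_one_sub_inv_le_one_iff`).  Precisely: for every
`0 < r < 1`, removing the (finitely many) pole contributions `m(ρ) Re z_ρ^{−n}` with `|z_ρ| ≤ r` leaves
`o(r^{−n})`.  Under RH every such sum is empty and the statement reads `λ_n = o(r^{−n})` for all `r < 1`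
([Voros2006] p.5, l.1–2).  The printed (DA)/(RS) carry `+Σ z_k^{−n}` and an infinite sum «mod o(e^{εn})
∀ε»; the form below is the author's corrected and finite-radius one.  Printed consequence (p.4):
«Concretely, `λ_n` then oscillates between exponentially growing values of both signs» — a remark, not
typed.  Proof route in print: `f(z) = Σ λ_n z^{n−1} = (log Ξ(1/(1−z)))'` has simple poles of residue
`m(ρ)` at the `z_ρ` in the unit disc; Darboux/Cauchy on `|z| = r`.  PROVED: `Voros2006_eqDA_holds`
(`KeiperLiAsymptoticCriteriaProofs.lean`). [cite: Voros2006, §3 eq. (DA) p.4, Theorem eq. (RS) p.6; Voros2018, §1.2 fn. 1, eq. (ASF) p.3] -/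
def Voros2006_eqDA : Prop :=
  ∀ r : ℝ, 0 < r → r < 1 →
    (fun n : ℕ ↦ keiperLiCoeff n +
        ∑ᶠ ρ ∈ {ρ : ℂ | ρ ∈ ZetaZeros.riemannZetaNontrivialZeros ∧ ‖1 - 1 / ρ‖ ≤ r},
          (riemannZetaZeroOrder ρ : ℝ) * (((1 - 1 / ρ)⁻¹) ^ n).re)
      =o[atTop] (fun n : ℕ ↦ r⁻¹ ^ n)

/-! ## §4. Trend and oscillating part ([Voros2006] §4): `S̄_n = liTrend n`, `S_n = liOscPart n` -/

/-- RH-FREE NAMED FACT ([Voros2006] §4, eqs. (4.4)–(TS), p.7, «unconditionally»): **the full asymptotic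
expansion of the trend**.  Printed: `Ŝ_n` is asymptotically `(−1)^{n−1} n! Res_{σ=1} J(σ) = ½ n[ψ(n) + log 2
− 1 + 2γ]` «(mod `o(n^{−N})` ∀ `N > 0`) because `J(σ)` has no further singularities», whence (TS)
`S̄_n ∼ ½ n(log n − 1 + γ − log 2π) + ¾ − Σ_{k≥1} B_{2k}/(4k) n^{1−2k}`.  With `S̄_n = 1 − (log 4π + γ)n/2 +
Ŝ_n` (TN) and `ψ(n) = H_{n−1} − γ = H_n − 1/n − γ`, the main term `1 − (log 4π + γ)n/2 + ½ n[ψ(n) + log 2 − 1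
+ 2γ]` is EXACTLY `(n/2)(H_n − 1 − log 2π) + ½`, the centring used by the tree's
`abs_keiperLiCoeff_sub_osc_sub_trend_le` (error `≤ 2/π`) and `tendsto_keiperLiCoeff_sub_osc_sub_trend`
(error `→ 0`, rate `O(1/n)`); the fact below is the printed strengthening «`o(n^{−N})` for every `N`»
(this is the `-- TODO(general form)` recorded in `KeiperLiTrend.lean`).  `S̄_n = liTrend n`
(`keiperLiCoeff_sub_osc_eq_liTrend`).  PROVED: `Voros2006_eqTS_holds` (`KeiperLiTrendAsymptoticProofs.lean`,
all-orders Stirling splitting `VorosTS.trendGen_eq`).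
[cite: Voros2006, §4 eqs. (4.4), (TS) p.7] -/
def Voros2006_eqTS : Prop :=
  ∀ N : ℕ,
    (fun n : ℕ ↦ liTrend n - ((n : ℝ) / 2 * ((harmonic n : ℝ) - 1 - Real.log (2 * Real.pi)) + 1 / 2))
      =o[atTop] (fun n : ℕ ↦ (n : ℝ) ^ (-(N : ℤ)))

/-- RH-FREE. The trend differs from the printed main term by a bounded amount:
`|S̄_n − ½ n(log n − 1 + γ − log 2π)| ≤ 1 + 2/π` for `n ≥ 1` (from the tree's `keiperLiTrend_log_bounds`).
[cite: Voros2006, §4 eq. (TS) p.7 (leading terms)] -/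
theorem abs_liTrend_sub_mainTerm_le {n : ℕ} (hn : 1 ≤ n) :
    |liTrend n - (n : ℝ) / 2 * (Real.log n - 1 + Real.eulerMascheroniConstant - Real.log (2 * Real.pi))|
      ≤ 1 + 2 / Real.pi := by
  have h := keiperLiTrend_log_bounds hn
  rw [keiperLiCoeff_sub_osc_eq_liTrend hn] at h
  have e : (n : ℝ) / 2 * (Real.log n + Real.eulerMascheroniConstant - 1 - Real.log (2 * Real.pi)) =
      (n : ℝ) / 2 * (Real.log n - 1 + Real.eulerMascheroniConstant - Real.log (2 * Real.pi)) := by ring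
  rw [e] at h
  have hπ : 0 < 2 / Real.pi := by positivity
  rw [abs_le]
  constructor <;> linarith [h.1, h.2]

/-- RH-CONSEQUENCE (explicit binder), PROVED from the named fact `Voros2006_thm_onlyif` and the RH-FREE
trend law — **[Voros2006] §4, eq. (SLN), p.7**: `S_n = o(n)` [RH true], i.e. under RH the oscillating
(arithmetic) part `liOscPart n = −Σ_{j=1}^n C(n,j) η_{j−1}` is `o(n)` («a case further discussed in
[M2,S,C2]»; of RH strength: by Bombieri–Lagarias, `S_n = o(n)` unconditionally would imply RH).
[cite: Voros2006, §4 eq. (SLN) p.7] -/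
theorem isLittleO_liOscPart_of_onlyif (h : Voros2006_thm_onlyif) (hRH : RiemannHypothesis) :
    (fun n : ℕ ↦ liOscPart n) =o[atTop] (fun n : ℕ ↦ (n : ℝ)) := by
  have h1 := h hRH
  -- the bounded difference `trend − main term` is `o(n)`
  have h2 : (fun n : ℕ ↦ liTrend n -
      (n : ℝ) / 2 * (Real.log n - 1 + Real.eulerMascheroniConstant - Real.log (2 * Real.pi)))
        =o[atTop] (fun n : ℕ ↦ (n : ℝ)) := by
    have hb : (fun n : ℕ ↦ liTrend n -
        (n : ℝ) / 2 * (Real.log n - 1 + Real.eulerMascheroniConstant - Real.log (2 * Real.pi)))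
          =O[atTop] (fun _ : ℕ ↦ (1 : ℝ)) := by
      refine IsBigO.of_bound (1 + 2 / Real.pi) ?_
      filter_upwards [eventually_ge_atTop 1] with n hn
      rw [Real.norm_eq_abs, norm_one, mul_one]
      exact abs_liTrend_sub_mainTerm_le hn
    refine hb.trans_isLittleO ?_
    rw [isLittleO_const_left]
    exact Or.inr (tendsto_norm_atTop_atTop.comp tendsto_natCast_atTop_atTop)
  have h3 := h1.sub h2
  refine h3.congr' ?_ (EventuallyEq.refl _ _)
  filter_upwards [eventually_ge_atTop 1] with n hn
  have hc := (Coffey2005_thm1_holds).2 n hn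
  linarith

/-! ## §5. Coffey 2008, §2–§4: Stieltjes constants, zero power sums, and the `η_j` -/

/-- RH-FREE (definition). The sequence whose limit is the Stieltjes constant `γ_k`:
`N ↦ Σ_{m=1}^N (log m)^k/m − (log N)^{k+1}/(k+1)`. [cite: Coffey2008, eq. (3.2) p.714] -/
def stieltjesGammaSeq (k N : ℕ) : ℝ :=
  (∑ m ∈ Finset.Icc 1 N, Real.log (m : ℝ) ^ k / (m : ℝ)) - Real.log (N : ℝ) ^ (k + 1) / ((k : ℝ) + 1)

/-- RH-FREE (definition). **The Stieltjes constants** `γ_k := lim_{N→∞} (Σ_{m=1}^N (log m)^k/m −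
(log N)^{k+1}/(k+1))` ([Coffey2008] (3.2); Stieltjes 1905, Briggs 1955), the coefficients of the Laurent
expansion `ζ(s) = 1/(s−1) + Σ_{n≥0} ((−1)^n/n!) γ_n (s−1)^n` ((3.1), typed as `Coffey2008_eq31`).  Defined by
`limUnder`; the limit exists (`tendsto_stieltjesGammaSeq`, from the tree's
`tendsto_sum_log_pow_div_sub_exists`), `γ₀ = γ` (`stieltjesGamma_zero`). [cite: Coffey2008, eqs. (3.1)–(3.2) p.714] -/
def stieltjesGamma (k : ℕ) : ℝ :=
  limUnder atTop (stieltjesGammaSeq k)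

/-- RH-FREE, PROVED. The limit defining `γ_k` exists and equals `stieltjesGamma k`.
[cite: Coffey2008, eq. (3.2) p.714] -/
theorem tendsto_stieltjesGammaSeq (k : ℕ) :
    Tendsto (stieltjesGammaSeq k) atTop (𝓝 (stieltjesGamma k)) := by
  obtain ⟨L, hL⟩ := tendsto_sum_log_pow_div_sub_exists k
  exact tendsto_nhds_limUnder ⟨L, hL⟩

/-- RH-FREE, PROVED. `γ₀ = γ` (Euler's constant): `Σ_{m=1}^N 1/m − log N → γ`.
[cite: Coffey2008, Remark 3.3 (ii) p.715 («the value of η₀ is −γ») and eq. (3.2)] -/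
theorem stieltjesGamma_zero : stieltjesGamma 0 = Real.eulerMascheroniConstant := by
  have h1 := tendsto_stieltjesGammaSeq 0
  have h2 : Tendsto (stieltjesGammaSeq 0) atTop (𝓝 Real.eulerMascheroniConstant) := by
    have h3 := Real.tendsto_eulerMascheroniSeq'
    refine h3.congr' ?_
    filter_upwards [eventually_ne_atTop 0] with N hN
    rw [Real.eulerMascheroniSeq', if_neg hN, stieltjesGammaSeq, sum_Icc_eq_sum_range_succ]
    simp [harmonic]
  exact tendsto_nhds_unique h1 h2

/-- RH-FREE NAMED FACT ([Coffey2008] eq. (3.1) with (3.2), p.714; Stieltjes 1905, Briggs 1955): **the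
Laurent expansion of `ζ` at `s = 1` in the Stieltjes constants**, `ζ(s) = 1/(s−1) + Σ_{n≥0} ((−1)^n/n!)
γ_n (s−1)^n`, i.e. the Taylor coefficients of the entire function `ζ₁(s) = (s−1)ζ(s)` at `1` (the tree's
`Xiao2020.zetaOneTaylorCoeff i = ζ₁^{(i)}(1)/i!`, `u₀ = 1`, `u₁ = γ`) are `u_{n+1} = (−1)^n γ_n/n!`.  At
`n = 0` this is the tree's `zetaOneTaylorCoeff_one` with `stieltjesGamma_zero`.  PROVED: `Coffey2008_eq31_holds` (`KeiperLiAsymptoticCriteriaProofs.lean`; an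
Abelian comparison as in `BombieriLagariasEtaIdentification.lean`).
[cite: Coffey2008, eqs. (3.1)–(3.2) p.714] -/
def Coffey2008_eq31 : Prop :=
  ∀ n : ℕ, Xiao2020.zetaOneTaylorCoeff (n + 1) =
    (((-1 : ℝ) ^ n * stieltjesGamma n / (n.factorial : ℝ) : ℝ) : ℂ)

/-- RH-FREE (definition). **The power sums over the zeros** `σ_k = Σ_ρ ρ^{−k}` «where the sum is over all
the complex zeros of the zeta function» ([Coffey2008] (3.3) p.714; Lehmer 1988, Matsuoka 1985; Voros's
`𝒵_j`, [Voros2006] §2 p.3), with multiplicities and with the standard SYMMETRIC summation convention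
(pairing `ρ` with `1 − ρ`, [Voros2018] §1 (SG)): `σ_k := ½ Σ_ρ m(ρ)(ρ^{−k} + (1−ρ)^{−k})`.  For `k ≥ 2` this
is the absolutely convergent `Σ_ρ m(ρ) ρ^{−k}` (the zero set is stable under `ρ ↦ 1−ρ` with the same
multiplicities); for `k = 1` it is the conditionally convergent `σ₁ = Σ_ρ 1/ρ = ½ Σ_ρ m(ρ)/(ρ(1−ρ)) = λ₁`
((3.7)).  Real, by conjugation symmetry of the zeros. [cite: Coffey2008, eq. (3.3) p.714] -/
def zetaZeroPowerSum (k : ℕ) : ℂ :=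
  1 / 2 * ∑' ρ : ZetaZeros.riemannZetaNontrivialZeros,
    (riemannZetaZeroOrder (ρ : ℂ) : ℂ) * (((ρ : ℂ)⁻¹) ^ k + ((1 - (ρ : ℂ))⁻¹) ^ k)

/-- RH-FREE, PROVED. `σ₁ = ½ Σ_ρ m(ρ)/(ρ(1−ρ)) = β/2` (`β = nicolasBeta`).
[cite: Coffey2008, eqs. (3.7), (4.8) p.714, 717] -/
theorem zetaZeroPowerSum_one : zetaZeroPowerSum 1 = (nicolasBeta : ℂ) / 2 := by
  have h := tsum_zeroOrder_div_mul_one_sub_eq_nicolasBeta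
  unfold zetaZeroPowerSum
  simp only [pow_one]
  have e : (fun ρ : ZetaZeros.riemannZetaNontrivialZeros ↦
      (riemannZetaZeroOrder (ρ : ℂ) : ℂ) * (((ρ : ℂ))⁻¹ + (1 - (ρ : ℂ))⁻¹)) =
      fun ρ : ZetaZeros.riemannZetaNontrivialZeros ↦
        (riemannZetaZeroOrder (ρ : ℂ) : ℂ) / ((ρ : ℂ) * (1 - ρ)) := by
    funext ρ
    have h0 : (ρ : ℂ) ≠ 0 := by
      intro h0
      have := ZetaZeros.riemannZetaNontrivialZeros.re_pos ρ.2
      rw [h0] at this; simp at this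
    have h1 : (1 : ℂ) - ρ ≠ 0 := by
      intro h1
      have := ZetaZeros.riemannZetaNontrivialZeros.re_lt_one ρ.2
      have e1 : (ρ : ℂ) = 1 := by linear_combination -h1
      rw [e1] at this; simp at this
    field_simp
    ring
  rw [e]
  exact (congrArg (fun z : ℂ ↦ 1 / 2 * z) h).trans (by ring)

/-- RH-FREE NAMED FACT ([Coffey2008] eq. (3.4) p.714; from the Hadamard product `2ξ(s) = Π_ρ(1 − s/ρ)`):
**`log ξ(s) = −log 2 − Σ_{k≥1} (−1)^k (σ_k/k)(s − 1)^k`**, i.e. the Taylor coefficients `a_k =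
(log ξ)^{(k)}(1)/k!` (tree: `Xiao2020.logXiTaylorCoeff k`) are `a_k = (−1)^{k+1} σ_k/k`, `k ≥ 1`; with the
tree's `ξ(1) = ½` the constant term is `−log 2` as printed.  PROVED: `Coffey2008_eq34_holds`
(`KeiperLiAsymptoticCriteriaProofs.lean`; the `k`-fold differentiated Hadamard product at `s = 1`,
`tendsto_finsum_liZeroBox_powerSum`; the case `k = 1` is the tree's `logDeriv_riemannXi_one`). [cite: Coffey2008, eq. (3.4) p.714] -/
def Coffey2008_eq34 : Prop :=
  ∀ k : ℕ, 1 ≤ k → zetaZeroPowerSum k = (-1) ^ (k + 1) * (k : ℂ) * Xiao2020.logXiTaylorCoeff k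

/-- RH-FREE, PROVED from `Coffey2008_eq34` and the tree's `keiperLiCoeff_eq_sum_logXiTaylorCoeff`
(Leibniz) — **[Coffey2008] eq. (3.5) p.714 = Keiper's formula** ([Voros2006] §2 p.3, «It was already known
that `λ_n = Σ_{j=1}^n (−1)^{j+1} C(n,j) 𝒵_j` [K]»): `λ_n = −Σ_{j=1}^n (−1)^j C(n,j) σ_j`.
[cite: Coffey2008, eq. (3.5) p.714; Voros2006, §2 p.3] -/
theorem keiperLiCoeff_eq_sum_zetaZeroPowerSum (h : Coffey2008_eq34) {n : ℕ} (hn : 1 ≤ n) :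
    keiperLiCoeff n =
      -∑ j ∈ Finset.Icc 1 n, (-1 : ℝ) ^ j * (n.choose j : ℝ) * (zetaZeroPowerSum j).re := by
  -- both sides equal `Σ_{j=1}^n C(n,j) j Re a_j`; the left by Leibniz (tree), summed over `range n`
  rw [Xiao2020.keiperLiCoeff_eq_sum_logXiTaylorCoeff hn, ← Finset.sum_neg_distrib,
    sum_Icc_eq_sum_range_succ]
  refine Finset.sum_congr rfl fun j _ ↦ ?_
  rw [h (j + 1) (by omega)]
  have e1 : ((-1 : ℂ) ^ (j + 1 + 1) * ((j + 1 : ℕ) : ℂ) * Xiao2020.logXiTaylorCoeff (j + 1)).re =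
      (-1 : ℝ) ^ (j + 1 + 1) * ((j + 1 : ℕ) : ℝ) * (Xiao2020.logXiTaylorCoeff (j + 1)).re := by
    have : (-1 : ℂ) ^ (j + 1 + 1) * ((j + 1 : ℕ) : ℂ) = (((-1 : ℝ) ^ (j + 1 + 1) * ((j + 1 : ℕ) : ℝ) : ℝ) : ℂ) := by
      push_cast; ring
    rw [this, Complex.re_ofReal_mul]
  rw [e1, pow_succ (-1 : ℝ) (j + 1)]
  have e2 : ((-1 : ℝ) ^ (j + 1)) * (-1) ^ (j + 1) = 1 := by
    rw [← pow_add, ← two_mul, pow_mul]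
    norm_num
  push_cast
  linear_combination (-(n.choose (j + 1) : ℝ)) * ((j : ℝ) + 1) *
    (Xiao2020.logXiTaylorCoeff (j + 1)).re * e2

/-- RH-FREE, PROVED. `η₀ = −γ` ([Coffey2008] Remark 3.3 (ii) p.715, «the value of `η₀` is `−γ`»): from the
tree's `liEta_eq_neg_re_zetaOneLogDerivCoeff` and `q₀ = ζ₁'(1)/ζ₁(1) = γ` (`deriv_riemannZeta₁_one`).
[cite: Coffey2008, Remark 3.3 (ii) p.715] -/
theorem liEta_zero : liEta 0 = -Real.eulerMascheroniConstant := by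
  rw [liEta_eq_neg_re_zetaOneLogDerivCoeff]
  simp only [Xiao2020.zetaOneLogDerivCoeff, iteratedDeriv_zero, Nat.factorial_zero, Nat.cast_one,
    div_one, logDeriv_apply, deriv_riemannZeta₁_one, riemannZeta₁_one, Complex.ofReal_re]

/-- RH-FREE, PROVED from `Coffey2008_eq34` and the tree (`logXiTaylorCoeff_succ`,
`liEta_eq_neg_re_zetaOneLogDerivCoeff`) — **[Coffey2008] eq. (3.6) p.714** (Zhang–Williams 1994; Coffey
2005): for `k ≥ 2`, `σ_k = (−1)^k η_{k−1} − (1 − 2^{−k}) ζ(k) + 1` (real parts; `σ_k` is real).  This is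
also Voros's `𝒵_j = 1 − (1−2^{−j})ζ(j) + (−1)^j η_{j−1}` ([Voros2006] §2 p.3). [cite: Coffey2008, eq. (3.6) p.714; Voros2006, §2 p.3] -/
theorem re_zetaZeroPowerSum_eq (h : Coffey2008_eq34) {k : ℕ} (hk : 2 ≤ k) :
    (zetaZeroPowerSum k).re =
      (-1) ^ k * liEta (k - 1) - (1 - ((2 : ℝ) ^ k)⁻¹) * (riemannZeta k).re + 1 := by
  obtain ⟨j, rfl⟩ : ∃ j, k = j + 1 := ⟨k - 1, by omega⟩
  have hj : 1 ≤ j := by omega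
  simp only [Nat.add_sub_cancel]
  rw [h (j + 1) (by omega), liEta_eq_neg_re_zetaOneLogDerivCoeff]
  have hs := Xiao2020.logXiTaylorCoeff_succ hj
  -- `σ_{j+1} = (−1)^j (j+1) a_{j+1} = (−1)^j [q_j + (−1)^j (1 − (1−2^{−(j+1)}) ζ(j+1))]`
  have e : (-1 : ℂ) ^ (j + 1 + 1) * ((j + 1 : ℕ) : ℂ) * Xiao2020.logXiTaylorCoeff (j + 1) =
      (-1) ^ j * Xiao2020.zetaOneLogDerivCoeff j +
        (1 - (1 - 1 / 2 ^ (j + 1)) * riemannZeta ((j + 1 : ℕ) : ℂ)) := by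
    have e2 : ((-1 : ℂ) ^ j) * (-1) ^ j = 1 := by
      rw [← pow_add, ← two_mul, pow_mul]; norm_num
    rw [pow_succ, pow_succ]
    push_cast at hs ⊢
    linear_combination (-1 : ℂ) ^ j * hs + (1 - (1 - 1 / 2 ^ (j + 1)) * riemannZeta ((j : ℂ) + 1)) * e2
  rw [e, Complex.add_re, Complex.sub_re, Complex.one_re]
  have e3 : ((-1 : ℂ) ^ j * Xiao2020.zetaOneLogDerivCoeff j).re =
      (-1) ^ j * (Xiao2020.zetaOneLogDerivCoeff j).re := by
    rw [show ((-1 : ℂ) ^ j) = (((-1 : ℝ) ^ j : ℝ) : ℂ) by push_cast; ring, Complex.re_ofReal_mul]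
  have e4 : ((1 - 1 / 2 ^ (j + 1)) * riemannZeta ((j + 1 : ℕ) : ℂ)).re =
      (1 - ((2 : ℝ) ^ (j + 1))⁻¹) * (riemannZeta ((j + 1 : ℕ) : ℂ)).re := by
    rw [show ((1 : ℂ) - 1 / 2 ^ (j + 1)) = (((1 - ((2 : ℝ) ^ (j + 1))⁻¹ : ℝ)) : ℂ) by push_cast; ring,
      Complex.re_ofReal_mul]
  rw [e3, e4, pow_succ]
  ring

/-- RH-FREE, PROVED. **`λ₁ = ξ'(1)/ξ(1) = β/2`** (`β = nicolasBeta = 2 + γ − log π − 2 log 2`; tree: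
`logDeriv_riemannXi_one`). [cite: Coffey2008, eq. (3.7) p.714] -/
theorem keiperLiCoeff_one : keiperLiCoeff 1 = nicolasBeta / 2 := by
  rw [Xiao2020.keiperLiCoeff_eq_sum_logXiTaylorCoeff le_rfl, Finset.sum_range_one]
  simp only [zero_add, Nat.choose_self, one_mul, Nat.cast_one, Xiao2020.logXiTaylorCoeff,
    Nat.factorial_one, div_one, iteratedDeriv_one]
  have hslit : riemannXi 1 ∈ Complex.slitPlane := by
    rw [riemannXi_one, Complex.mem_slitPlane_iff]; norm_num
  rw [((differentiable_riemannXi 1).hasDerivAt.clog hslit).deriv, ← logDeriv_apply,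
    logDeriv_riemannXi_one]
  norm_cast

/-- RH-FREE, PROVED — **[Coffey2008] eq. (3.7) p.714**: `σ₁ = λ₁ = −½ log π + γ/2 + 1 − log 2`
(`= 0.0230957…`). [cite: Coffey2008, eq. (3.7) p.714] -/
theorem keiperLiCoeff_one_eq :
    keiperLiCoeff 1 = -(Real.log Real.pi / 2) + Real.eulerMascheroniConstant / 2 + 1 - Real.log 2 := by
  rw [keiperLiCoeff_one, nicolasBeta]
  ring

/-- RH-FREE, PROVED. (3.7) for the power sum: `Re σ₁ = λ₁`. [cite: Coffey2008, eq. (3.7) p.714] -/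
theorem re_zetaZeroPowerSum_one : (zetaZeroPowerSum 1).re = keiperLiCoeff 1 := by
  rw [zetaZeroPowerSum_one, keiperLiCoeff_one]
  norm_cast

/-- RH-FREE NAMED FACT — **[Coffey2008] Prop. 3.2, eq. (3.12) p.715** (Matsuoka 1985a, 1986, through
(3.6) and (3.9)): for `k ≥ 2`,

  `η_{k−1} = (−1)^k k Σ_{h=1}^k (1/h) Σ_{j₁,…,j_h ≥ 0, j₁+⋯+j_h = k−h} Π_{b=1}^h γ_{j_b}/j_b!`

(the inner sum over compositions of `k − h` into `h` non-negative parts, `Finset.Nat.antidiagonalTuple h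
(k−h)`).  E.g. `k = 2`: `η₁ = 2γ₁ + γ₀² = 2γ₁ + γ²`.  PROVED: `Coffey2008_prop32_holds`
(`KeiperLiAsymptoticCriteriaProofs.lean`; power-series algebra: `log ζ₁(s)` with
`ζ₁(s) = 1 + Σ_n ((−1)^n γ_n/n!)(s−1)^{n+1}`, i.e. `Coffey2008_eq31`, and `η_j = −q_j`). [cite: Coffey2008, Prop. 3.2 eq. (3.12) p.715] -/
def Coffey2008_prop32 : Prop :=
  ∀ k : ℕ, 2 ≤ k → liEta (k - 1) =
    (-1 : ℝ) ^ k * k * ∑ h ∈ Finset.Icc 1 k, (1 / (h : ℝ)) *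
      ∑ c ∈ Finset.Nat.antidiagonalTuple h (k - h), ∏ b, stieltjesGamma (c b) / ((c b).factorial : ℝ)

/-- RH-FREE NAMED FACT — **[Coffey2008] Prop. 3.1, eq. (3.10) p.715**: for `n ≥ 2`,

  `λ_n = 1 − (n/2)(log π + 2 log 2 − γ) + S₁(n)
        − Σ_{j=2}^n (−1)^j C(n,j) j Σ_{h=1}^j (1/h) Σ_{j₁+⋯+j_h = j−h} Π_b γ_{j_b}/j_b!`,

`S₁ = liArchSum` (Coffey's (2.4) = the tree's definition).  A consequence of Prop. 3.2 and the arithmetic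
formula (2.3) (`Coffey2005_thm1_holds`): `Coffey2008_prop31_of_prop32` below; PROVED outright as
`Coffey2008_prop31_holds` (`KeiperLiAsymptoticCriteriaProofs.lean`). [cite: Coffey2008, Prop. 3.1 eq. (3.10) p.715] -/
def Coffey2008_prop31 : Prop :=
  ∀ n : ℕ, 2 ≤ n → keiperLiCoeff n =
    1 - (n : ℝ) / 2 * (Real.log Real.pi + 2 * Real.log 2 - Real.eulerMascheroniConstant) + liArchSum n -
      ∑ j ∈ Finset.Icc 2 n, (-1 : ℝ) ^ j * (n.choose j : ℝ) * j *
        ∑ h ∈ Finset.Icc 1 j, (1 / (h : ℝ)) *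
          ∑ c ∈ Finset.Nat.antidiagonalTuple h (j - h), ∏ b, stieltjesGamma (c b) / ((c b).factorial : ℝ)

/-- RH-FREE, PROVED: **Prop. 3.1 follows from Prop. 3.2**, the arithmetic formula
`λ_n = liTrend n + liOscPart n` (`Coffey2005_thm1_holds`) and `η₀ = −γ` («Therefore, by combining this
equation with equations (3.7) and (3.8) and using the definition (2.4), we obtain proposition 3.1», p.715).
[cite: Coffey2008, Prop. 3.1 eq. (3.10) p.715] -/
theorem Coffey2008_prop31_of_prop32 (h : Coffey2008_prop32) : Coffey2008_prop31 := by
  intro n hn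
  have h1 := (Coffey2005_thm1_holds).2 n (by omega)
  rw [h1, liTrend_eq, liArchPart_eq, liOscPart_eq]
  -- split off the `m = 1` term of `S₂(n) = −Σ_{m=1}^n C(n,m) η_{m−1}`
  have hsplit : ∑ m ∈ Finset.Icc 1 n, (n.choose m : ℝ) * liEta (m - 1) =
      (n.choose 1 : ℝ) * liEta 0 + ∑ m ∈ Finset.Icc 2 n, (n.choose m : ℝ) * liEta (m - 1) := by
    have hI : Finset.Icc 1 n = insert 1 (Finset.Icc 2 n) := by
      ext m; simp only [Finset.mem_insert, Finset.mem_Icc]; omega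
    rw [hI, Finset.sum_insert (by simp)]
  rw [hsplit, Nat.choose_one_right, liEta_zero]
  have hterm : ∀ m ∈ Finset.Icc 2 n, (n.choose m : ℝ) * liEta (m - 1) =
      (-1 : ℝ) ^ m * (n.choose m : ℝ) * m *
        ∑ h' ∈ Finset.Icc 1 m, (1 / (h' : ℝ)) *
          ∑ c ∈ Finset.Nat.antidiagonalTuple h' (m - h'), ∏ b, stieltjesGamma (c b) / ((c b).factorial : ℝ) := by
    intro m hm
    rw [h m (Finset.mem_Icc.1 hm).1]
    ring
  rw [Finset.sum_congr rfl hterm]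
  ring

/-- RH-FREE NAMED FACT — **[Coffey2008] eq. (4.10) p.718** (from the functional equation
`ξ'/ξ(s) = −ξ'/ξ(1−s)` differentiated `j` times at `s = 1`, with `ξ'/ξ(s) = Σ_{k≥1} (−1)^{k+1} σ_k (s−1)^{k−1}`
of radius `|ρ₁ − 1| > 1`): for every `j ≥ 0`, `σ_{j+1} = (−1)^{j+1} Σ_{k≥j+1} C(k−1, j) σ_k`, the series
converging absolutely (at `j = 0`: `σ₁ = −Σ_{k≥1} σ_k`, (4.6)).  Typed with `k = i + j + 1`.  PROVED:
`Coffey2008_eq410_holds` (`KeiperLiAsymptoticCriteriaProofs.lean`). [cite: Coffey2008, eq. (4.10) p.718] -/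
def Coffey2008_eq410 : Prop :=
  ∀ j : ℕ, HasSum (fun i : ℕ ↦ (((i + j).choose j : ℕ) : ℂ) * zetaZeroPowerSum (i + j + 1))
    ((-1) ^ (j + 1) * zetaZeroPowerSum (j + 1))

/-- RH-FREE NAMED FACT — **[Coffey2008] Prop. 4.1, p.718–719** (summatory relation for the `η_j`),
**in the form produced by the printed proof** ((4.10) with (3.6) inserted on both sides, the odd-zeta sum
(4.13) `Σ_{k≥j} C(k,j)[1 − (1−2^{−(k+1)})ζ(k+1)] = −2^{−(j+1)} ζ(j+1)` via (4.14)): for `j ≥ 1`,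

  `[1 + (−1)^j] η_j = (−1)^j + {(−1)^{j+1} − [1 + (−1)^{j+1}] 2^{−(j+1)}} ζ(j+1) + Σ_{k≥j+1} (−1)^{k+1} C(k,j) η_k`,

the series converging absolutely (`|η_k| ≲ 3^{−k}`).  MISPRINT/OCR NOTE: the held text of (4.12)/(4.15) reads
the coefficient of `ζ(j+1)` as `{1 − [1 + (−1)^{j+1}] 2^{−(j+1)}}`; for ODD `j` the two forms coincide (both
say `Σ_{k≥j+1} (−1)^{k+1} C(k,j) η_k = 1 − (1 − 2^{−j}) ζ(j+1)`), for EVEN `j` they differ by `2ζ(j+1)` and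
only the form below is consistent with (4.10) and with the numerical values of the `η_k`
(`j = 2`: `2η₂ = −0.1034`, `1 − ζ(3) + Σ_{k≥3}(−1)^{k+1}C(k,2)η_k = −0.2021 + 0.0987`).  Typed with
`k = i + j + 1`.  PROVED: `Coffey2008_prop41_holds` (`KeiperLiAsymptoticCriteriaProofs.lean`).
[cite: Coffey2008, Prop. 4.1 eqs. (4.12)–(4.15) p.718–719 (corrected as stated)] -/
def Coffey2008_prop41 : Prop :=
  ∀ j : ℕ, 1 ≤ j →
    HasSum (fun i : ℕ ↦ (-1 : ℝ) ^ (i + j) * (((i + j + 1).choose j : ℕ) : ℝ) * liEta (i + j + 1))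
      ((1 + (-1 : ℝ) ^ j) * liEta j - (-1) ^ j -
        ((-1) ^ (j + 1) - (1 + (-1 : ℝ) ^ (j + 1)) * ((2 : ℝ) ^ (j + 1))⁻¹) * (riemannZeta (j + 1)).re)

/-- RH-FREE NAMED FACT — **[Coffey2008] Prop. 4.2, p.719**: «The sequence `{η_j}_{j≥0}`, with `η₀ = −γ`,
has strict sign alternation. That is, `η_j = −(−1)^j c_j`, `j = 0, 1, …`, for some positive constants
`c_j`.»  Printed proof: Matsuoka's asymptotic (4.16) `σ_n = 2(α₁² + ¼)^{−n/2} cos(n arctan 2α₁) +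
O[(α₂² + ¼)^{−n/2}]` (`½ + iα₁`, `½ + iα₂` the first two zeros), (3.6) and (4.17) `(1−2^{−k})ζ(k) − 1 >
3^{−k}` («The new result, proposition 4.2, was obtained by the author several years ago, as announced in
Coffey (2005a)», p.719).  Only the printed sign pattern is asserted — no quantitative bound on `|η_j|`.
PROVED, RH-FREE, for EVERY `j`: `Coffey2008_prop42_holds` (`KeiperLiAsymptoticCriteriaProofs.lean`; Ford's
`Σ_ρ m(ρ)/|ρ|² ≤ 0.0463` and `|ρ| > 14` in place of Matsuoka's asymptotic; the eventual form is
`eventually_sign_zetaOneLogDerivCoeff`, `ZetaLogDerivTaylorLaw.lean`).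
[cite: Coffey2008, Prop. 4.2 p.719] -/
def Coffey2008_prop42 : Prop :=
  ∀ j : ℕ, 0 < (-1 : ℝ) ^ (j + 1) * liEta j

/-- RH-FREE, PROVED — **[Coffey2008] eqs. (4.17)–(4.18) p.719** (with (2.6) p.713): for `k ≥ 2`,
`(1 − 2^{−k}) ζ(k) − 1 = 2^{−k} ζ(k, ½) − 1 = Σ_{j≥1} (2j+1)^{−k} > 3^{−k}` (from the tree's
`Xiao2020.hasSum_inv_odd_pow`: `Σ_{j≥0} (2j+1)^{−k} = (1 − 2^{−k}) ζ(k)`).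
[cite: Coffey2008, eqs. (4.17)–(4.18) p.719] -/
theorem three_pow_inv_lt_oddZeta_sub_one {k : ℕ} (hk : 2 ≤ k) :
    ((3 : ℝ) ^ k)⁻¹ < (1 - ((2 : ℝ) ^ k)⁻¹) * (riemannZeta k).re - 1 := by
  have h := Xiao2020.hasSum_inv_odd_pow hk
  -- pass to real parts
  have hre : HasSum (fun j : ℕ ↦ (((1 : ℝ) + 2 * (j : ℝ)) ^ k)⁻¹)
      (((1 - 1 / 2 ^ k) * riemannZeta (k : ℂ))).re := by
    have h2 := (Complex.hasSum_iff _ _).1 h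
    refine h2.1.congr_fun ?_
    intro j
    show _ = ((((1 : ℂ) + 2 * (j : ℂ)) ^ k)⁻¹).re
    rw [show (((1 : ℂ) + 2 * (j : ℂ)) ^ k)⁻¹ = (((((1 : ℝ) + 2 * (j : ℝ)) ^ k)⁻¹ : ℝ) : ℂ) by push_cast; ring,
      Complex.ofReal_re]
  have hval : (((1 - 1 / 2 ^ k) * riemannZeta (k : ℂ))).re = (1 - ((2 : ℝ) ^ k)⁻¹) * (riemannZeta k).re := by
    rw [show ((1 : ℂ) - 1 / 2 ^ k) = (((1 - ((2 : ℝ) ^ k)⁻¹ : ℝ)) : ℂ) by push_cast; ring,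
      Complex.re_ofReal_mul]
  rw [hval] at hre
  -- the partial sum over `{0, 1, 2}` is below the total
  have hle := sum_le_hasSum (Finset.range 3) (fun j _ ↦ by positivity) hre
  simp only [Finset.sum_range_succ, Finset.sum_range_zero, zero_add, Nat.cast_zero, mul_zero,
    add_zero, one_pow, inv_one, Nat.cast_one, mul_one, Nat.cast_ofNat] at hle
  have h5 : (0 : ℝ) < (((1 : ℝ) + 2 * 2) ^ k)⁻¹ := by positivity
  norm_num at hle ⊢
  linarith

/-! ## §6. Voros's discretized Keiper sequence `Λ_n` ([Voros2018] §2) -/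

/-- RH-FREE (definition). **The coefficients `A_{nm}`** of [Voros2018] eq. (Anm) p.5:
`A_{nm} = 2^{−2n} (n+m, n−m, 2m)!/(2m−1) ≡ (1/(2m−1)) · (1/((n−m)! m!)) · Γ(n+m+½)/Γ(m+½)`, where
`(i,j,k)! = (i+j+k)!/(i! j! k!)`; i.e. `A_{nm} = (2n+2m)! / (4ⁿ (2m−1) (n−m)! (n+m)! (2m)!)` (`0 ≤ m ≤ n`;
`A_{n0} = −(2n)!/(4ⁿ (n!)²) < 0`, `A_{11} = 3/2`).  Residues of `f_n`: `Res_{x=1} f_n = −(−1)ⁿ/A_{n0}`,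
`Res_{x=2m} f_n = (−1)^{n+m} A_{nm}`. [cite: Voros2018, §2.1 eq. (Anm) p.5] -/
def vorosA (n m : ℕ) : ℝ :=
  ((2 * n + 2 * m).factorial : ℝ) /
    ((4 : ℝ) ^ n * (2 * (m : ℝ) - 1) * ((n - m).factorial : ℝ) * ((n + m).factorial : ℝ) *
      ((2 * m).factorial : ℝ))

/-- RH-FREE (definition). **Voros's discretized Keiper sequence** ([Voros2018] §2.1, eqs. (Ldef)/(EKL)
p.5–6): `Λ_n := (1/2πi) ∮_{C_n} f_n(x) log 2ξ(x) dx ≡ (−1)ⁿ Σ_{m=1}^n (−1)^m A_{nm} log 2ξ(2m)`,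
`n = 1, 2, …`, «fully explicit» through `2ξ(2m) = (−1)^{m+1} B_{2m} (2π)^m/(2m−3)!!` (eq. (BE));
`Λ₁ = (3/2) log(π/3)`, `Λ₂ = (5/24) log[(2/5)⁷ 3¹¹/π⁴]`, `Λ₃ = (21/80) log[5²⁵ π⁸/(2³ (3²·7)¹¹)]`.  Here
`2ξ(2m) = 2 · riemannXi (2m) > 0` is real and we take `Real.log` of its real part.  REMARKS (not facts):
§3.1 asserts the «asymptotic alternative» (LNRH) `Λ_n ∼ Σ_{Re ρ'−½ ∈ 2n𝒟_{R₀}} F_n(ρ')  (mod o(Rⁿ)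
∀ R > R₀ > 1)` [RH false] / (LRH) `Λ_n ∼ ½ log n + C`, `C = ½(γ − log π − 1)` [RH true], derived by
steepest descent «with caveats» (§3.2) and, for (LRH), conditionally on «a nonstationary-phase principle»
(§3.3 step 1) — an Experimental-Mathematics derivation, NOT typed; §3.4 CONJECTURES the full Li-type
criterion `RH ⇔ Λ_n > 0 ∀n` («unproven») — never a Literature fact. [cite: Voros2018, §2.1 eqs. (Ldef), (EKL) p.5–6] -/
def vorosLambda (n : ℕ) : ℝ :=
  (-1) ^ n * ∑ m ∈ Finset.Icc 1 n, (-1 : ℝ) ^ m * vorosA n m * Real.log (2 * (riemannXi (2 * m)).re)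

/-- RH-FREE, PROVED. `A_{11} = 3/2`. [cite: Voros2018, §2.1 eq. (Anm) p.5] -/
theorem vorosA_one_one : vorosA 1 1 = 3 / 2 := by
  unfold vorosA
  norm_num [Nat.factorial]

/-- RH-FREE, PROVED — **[Voros2018] §2.1, p.6**: `Λ₁ = (3/2) log(π/3)` (since `2ξ(2) = π/3`, tree
`riemannXi_two`). [cite: Voros2018, §2.1 p.6 («Λ₁ = (3/2) log(π/3)»)] -/
theorem vorosLambda_one : vorosLambda 1 = 3 / 2 * Real.log (Real.pi / 3) := by
  unfold vorosLambda
  rw [Finset.Icc_self, Finset.sum_singleton, vorosA_one_one]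
  have h2 : (riemannXi (2 * (1 : ℕ))).re = Real.pi / 6 := by
    rw [show (2 * (1 : ℕ) : ℂ) = 2 by norm_num, riemannXi_two]
    norm_cast
  rw [h2]
  have : 2 * (Real.pi / 6) = Real.pi / 3 := by ring
  rw [this]
  ring

/-- RH-FREE NAMED FACT — **[Voros2018] §2.1, eq. (AID) p.5** (from `f_n(x) ∼ 1/x²` at infinity in the
partial-fraction decomposition (PFD)): for `n ≥ 1`,
`Σ_{m=0}^n (−1)^m A_{nm} = 1/A_{n0}` and `2 Σ_{m=1}^n (−1)^m A_{nm} m = (−1)ⁿ + 1/A_{n0}`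
(checked at `n = 1`: `−½ − 3/2 = −2 = 1/A_{10}`; `2·(−3/2) = −3 = −1 − 2`).  Elementary; PROVED: `Voros2018_eqAID_holds`
(`KeiperLiAsymptoticCriteriaProofs.lean`, Lagrange interpolation at the nodes `2i`, `1`). [cite: Voros2018, §2.1 eq. (AID) p.5] -/
def Voros2018_eqAID : Prop :=
  ∀ n : ℕ, 1 ≤ n →
    (∑ m ∈ Finset.range (n + 1), (-1 : ℝ) ^ m * vorosA n m = 1 / vorosA n 0) ∧
    (2 * ∑ m ∈ Finset.Icc 1 n, (-1 : ℝ) ^ m * vorosA n m * m = (-1) ^ n + 1 / vorosA n 0)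

/-- RH-FREE (definition). **The primitive `F_n` of `f_n`** ([Voros2018] §2.3, eq. (Fdef) p.6):
`F_n(x) = ∫_∞^x f_n = (−1)ⁿ [−(1/A_{n0}) log(x−1) + Σ_{m=0}^n (−1)^m A_{nm} log(x−2m)]`, single-valued on
`ℂ` minus the cut `[0, 2n]` (the logarithmic coefficients sum to zero by (AID)); principal logarithms.
E.g. `F₁(x) = ½ log[x(x−2)³/(x−1)⁴]`. [cite: Voros2018, §2.3 eq. (Fdef) p.6] -/
def vorosF (n : ℕ) (x : ℂ) : ℂ :=
  (-1) ^ n * (-(1 / (vorosA n 0 : ℂ)) * Complex.log (x - 1) +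
    ∑ m ∈ Finset.range (n + 1), (-1 : ℂ) ^ m * (vorosA n m : ℂ) * Complex.log (x - 2 * (m : ℂ)))

/-- RH-FREE NAMED FACT — **[Voros2018] §2.3, eq. (LIR) p.6** («Proof (outlined)»: integrate (Ldef) by
parts against `ξ'/ξ`, push the contour to infinity using `⟨F_n⟩ = O(1/x²)` and `|ζ'/ζ| < K log² R` away
from ordinates): **`Λ_n = Σ*_ρ F_n(ρ)`**, `n ≥ 1`, the sum over the non-trivial zeros with multiplicity,
«ordered symmetrically» (rule (SG)) — typed, as the tree's `keiperLiCoeff_eq_zero_sum`, as the limit of the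
sums over the symmetric boxes `liZeroBox T` (`|Im ρ| ≤ T`; the terms decay like `1/ρ`).  PROVED:
`Voros2018_eqLIR_holds` (`VorosLiIntegralRepresentationProofs.lean`, rh-crit-dbl-t12: by the Hadamard
product of `ξ` over the pairs `{ρ_k, 1−ρ_k}` — `F_n = Σ_p c_p log(x−p)` with `Σ_p c_p = 0` by (AID),
`Re F_n(ρ_k) + Re F_n(1−ρ_k) = Σ_p c_p log|1−b_k(2p−1)²|`, reality of the box sums). [cite: Voros2018, §2.3 eq. (LIR) p.6] -/
def Voros2018_eqLIR : Prop :=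
  ∀ n : ℕ, 1 ≤ n →
    Tendsto (fun T : ℝ ↦ ∑ᶠ ρ ∈ liZeroBox T, (riemannZetaZeroOrder ρ : ℂ) * vorosF n ρ)
      atTop (𝓝 (vorosLambda n : ℂ))

end Literature.NumberTheory.LFunctions
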